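import Mathlib.Probability.Distributions.Gaussian.Real
import Mathlib.Analysis.SpecialFunctions.Gaussian.GaussianIntegral
import Literature.MathematicalPhysics.KineticTheory.InfiniteChainDynamics
import HarnessLib

/-!
# Momenta are Gaussian under every Gibbs state of the chain (LLL 1977, §4 remark (ii))

Topic `Literature/MathematicalPhysics/KineticTheory`; proofs-only companion of
`InfiniteChainDynamics.lean`. Lanford–Lebowitz–Lieb (J. Stat. Phys. **16** (1977), p. 459,
remark (ii) before Theorem 3): "with respect to any Gibbs state, the `p_i` are independent,
identically distributed, Gaussian random variables of mean zero". We prove the part of this used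
in the proof of their Theorem 3: under any Gibbs state `μ` of the chain at temperature `T > 0`
(condition B2: the one-site Gibbs distributions (14) are normalisable), each momentum `p_i` has law
`N(0, T)`:

* `hamiltonianIn_chain_singleton`: `H_{{i}}(σ) = ½ p_i² + U(q_i) + V(q_{i+1} - q_i) + V(q_i - q_{i-1})`
  (LLL (10) for `Λ = {i}`);
* `map_snd_chainSpecification_singleton`: for every boundary condition `η`, the `p_i`-marginal of
  `γ_{{i}}(· | η)` is `gaussianReal 0 T` (the density `e^{-H/T}` factorises; Fubini on `ℝ × ℝ`;
  the normalisation is fixed by `γ` being a probability measure, so no partition function is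
  computed);
* `map_snd_eq_gaussianReal`: for every Gibbs state `μ` (DLR with `Λ = {i}`), `μ ∘ p_i⁻¹ = N(0, T)`;
  `lintegral_comp_snd_eq`: `∫ g(p_i) dμ = ∫ g dN(0, T)`.

Independence of the `p_i` (not needed for Theorem 3) is not formalised. Everything here is
proved; no named facts. [cite: LanfordLebowitzLieb1977, §4 remark (ii)]
-/

noncomputable section

open MeasureTheory ProbabilityTheory Filter Topology Set Literature.Probability.LatticeModels
open scoped ENNReal NNReal

namespace Literature.MathematicalPhysics.KineticTheory.HeatConduction

namespace OscillatorChain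

variable (P : OscillatorChain)

/-! ### The one-site Hamiltonian -/

/-- The interaction sets meeting `{i}`: `{i}`, `{i, i+1}`, `{i-1, i}`. [folklore] -/
theorem chainSupp_singleton (i : ℤ) :
    chainSupp {i} = {({i} : Finset ℤ), {i, i + 1}, {i - 1, i}} := by
  simp [chainSupp]

/-- **LLL (10) for `Λ = {i}`**: `H_{{i}}(σ) = ½ p_i² + U(q_i) + V(q_{i+1} - q_i) + V(q_i - q_{i-1})`.
[cite: LanfordLebowitzLieb1977, §2 eq. (10)] -/
theorem hamiltonianIn_chain_singleton (σ : ChainConfig) (i : ℤ) :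
    hamiltonianIn P.chainPotential chainSupp {i} σ =
      ((σ i).2 ^ 2 / 2 + P.U (σ i).1) +
        (P.V ((σ (i + 1)).1 - (σ i).1) + P.V ((σ i).1 - (σ (i - 1)).1)) := by
  have hA : ({i} : Finset ℤ) ≠ {i, i + 1} := by
    intro h
    have hm : i + 1 ∈ ({i} : Finset ℤ) := h ▸ (by simp)
    simp only [Finset.mem_singleton] at hm
    omega
  have hB : ({i} : Finset ℤ) ≠ {i - 1, i} := by
    intro h
    have hm : i - 1 ∈ ({i} : Finset ℤ) := h ▸ (by simp)
    simp only [Finset.mem_singleton] at hm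
    omega
  have hC : ({i, i + 1} : Finset ℤ) ≠ {i - 1, i} := by
    intro h
    have hm : i + 1 ∈ ({i - 1, i} : Finset ℤ) := h ▸ (by simp)
    simp only [Finset.mem_insert, Finset.mem_singleton] at hm
    omega
  have h1 : ({i} : Finset ℤ) ∉ ({{i, i + 1}, {i - 1, i}} : Finset (Finset ℤ)) := by
    simp only [Finset.mem_insert, Finset.mem_singleton, not_or]
    exact ⟨hA, hB⟩
  have h2 : ({i, i + 1} : Finset ℤ) ∉ ({{i - 1, i}} : Finset (Finset ℤ)) := by
    simp only [Finset.mem_singleton]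
    exact hC
  have hfilter : (chainSupp {i}).filter (fun A => (A ∩ {i}).Nonempty) =
      {({i} : Finset ℤ), {i, i + 1}, {i - 1, i}} := by
    rw [chainSupp_singleton]
    refine Finset.filter_true_of_mem fun A hA => ?_
    simp only [Finset.mem_insert, Finset.mem_singleton] at hA
    rcases hA with rfl | rfl | rfl <;> exact ⟨i, by simp⟩
  have hpair : P.chainPotential {i - 1, i} σ = P.V ((σ i).1 - (σ (i - 1)).1) := by
    have := P.chainPotential_pair σ (i - 1)
    rwa [sub_add_cancel] at this
  rw [hamiltonianIn, hfilter, Finset.sum_insert h1, Finset.sum_insert h2, Finset.sum_singleton,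
    chainPotential_singleton, chainPotential_pair, hpair]

/-- The one-site Hamiltonian is continuous (`U, V` continuous). [folklore] -/
theorem continuous_hamiltonianIn_chain_singleton (hU : Continuous P.U) (hV : Continuous P.V)
    (i : ℤ) : Continuous fun σ : ChainConfig => hamiltonianIn P.chainPotential chainSupp {i} σ := by
  simp only [hamiltonianIn_chain_singleton]
  fun_prop

/-! ### The one-site Gibbs distribution in coordinates -/

/-- Insert the one-particle datum `z = (q, p)` at site `i` into the configuration `η`. [folklore] -/
def siteInsert (i : ℤ) (η : ChainConfig) (z : ℝ × ℝ) : ChainConfig := glueWith {i} (fun _ => z) η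

variable {P}

/-- `siteInsert` at the site. [folklore] -/
@[simp] theorem siteInsert_apply_self (i : ℤ) (η : ChainConfig) (z : ℝ × ℝ) : siteInsert i η z i = z :=
  glueWith_apply_mem _ _ _ (Finset.mem_singleton_self i)

/-- `siteInsert` off the site. [folklore] -/
theorem siteInsert_apply_of_ne {i j : ℤ} (h : j ≠ i) (η : ChainConfig) (z : ℝ × ℝ) : siteInsert i η z j = η j :=
  glueWith_apply_not_mem _ _ _ (by simpa using h)

/-- `siteInsert` is measurable. [folklore] -/
theorem measurable_siteInsert (i : ℤ) (η : ChainConfig) : Measurable (siteInsert i η) := by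
  refine measurable_pi_iff.2 fun j => ?_
  by_cases h : j = i
  · subst h
    simp only [siteInsert_apply_self]
    exact measurable_id
  · simp only [siteInsert_apply_of_ne h]
    exact measurable_const

/-- The a priori measure `(Leb^{⊗{i}}) ∘ glueWith⁻¹` of the one-site specification is the image of
Lebesgue measure on `ℝ × ℝ` under `siteInsert`. [folklore] -/
theorem map_glueWith_singleton (i : ℤ) (η : ChainConfig) :
    (Measure.pi fun _ : ({i} : Finset ℤ) => (volume : Measure (ℝ × ℝ))).map
        (fun ζ => glueWith {i} ζ η) = (volume : Measure (ℝ × ℝ)).map (siteInsert i η) := by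
  haveI : Unique (({i} : Finset ℤ) : Type) :=
    ⟨⟨⟨i, Finset.mem_singleton_self i⟩⟩, fun j => Subtype.ext (Finset.mem_singleton.1 j.2)⟩
  have hpi : (Measure.pi fun _ : ({i} : Finset ℤ) => (volume : Measure (ℝ × ℝ))) =
      (volume : Measure (ℝ × ℝ)).map
        (MeasurableEquiv.piUnique fun _ : ({i} : Finset ℤ) => ℝ × ℝ).symm :=
    ((measurePreserving_piUnique fun _ : ({i} : Finset ℤ) => (volume : Measure (ℝ × ℝ))).symm
      _).map_eq.symm
  have hcomp : (fun ζ : ({i} : Finset ℤ) → ℝ × ℝ => glueWith {i} ζ η) ∘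
      (MeasurableEquiv.piUnique fun _ : ({i} : Finset ℤ) => ℝ × ℝ).symm = siteInsert i η := by
    funext z
    simp only [Function.comp_apply, siteInsert]
    congr 1
  rw [hpi, Measure.map_map (measurable_glueWith _ _) (MeasurableEquiv.measurable _), hcomp]

/-- The unnormalised Gaussian weight `e^{-p²/(2T)}`. [folklore] -/
def gaussWeight (T : ℝ) (p : ℝ) : ℝ≥0∞ := ENNReal.ofReal (Real.exp (-p ^ 2 / (2 * T)))

/-- Measurability of the Gaussian weight. [folklore] -/
theorem measurable_gaussWeight (T : ℝ) : Measurable (gaussWeight T) :=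
  ENNReal.measurable_ofReal.comp (by fun_prop)

/-- `∫ e^{-p²/(2T)} dp = √(2πT)`. [folklore] -/
theorem lintegral_gaussWeight {T : ℝ} (hT : 0 < T) :
    ∫⁻ p, gaussWeight T p = ENNReal.ofReal (Real.sqrt (2 * Real.pi * T)) := by
  have hb : 0 < 1 / (2 * T) := by positivity
  have e : (fun p : ℝ => Real.exp (-p ^ 2 / (2 * T))) = fun p => Real.exp (-(1 / (2 * T)) * p ^ 2) := by
    funext p; congr 1; ring
  unfold gaussWeight
  rw [← ofReal_integral_eq_lintegral_ofReal, e, integral_gaussian]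
  · congr 1
    rw [div_div_eq_mul_div]
    congr 1
    ring
  · rw [e]; exact integrable_exp_neg_mul_sq hb
  · exact Eventually.of_forall fun p => (Real.exp_pos _).le

/-- `N(0, T)` is the normalised Gaussian weight. [folklore] -/
theorem gaussianReal_eq_smul_withDensity {T : ℝ} (hT : 0 < T) :
    gaussianReal 0 T.toNNReal =
      (ENNReal.ofReal (Real.sqrt (2 * Real.pi * T)))⁻¹ • volume.withDensity (gaussWeight T) := by
  have hv : T.toNNReal ≠ 0 := by
    rw [Ne, Real.toNNReal_eq_zero, not_le]
    exact hT
  rw [gaussianReal_of_var_ne_zero _ hv, ← withDensity_smul _ (measurable_gaussWeight T)]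
  congr 1
  funext p
  rw [gaussianPDF, gaussianPDFReal, Real.coe_toNNReal _ hT.le, Pi.smul_apply, smul_eq_mul,
    gaussWeight, sub_zero, ENNReal.ofReal_mul (by positivity),
    ENNReal.ofReal_inv_of_pos (by positivity)]

/-- **The `p_i`-marginal of the one-site Gibbs distribution is `N(0, T)`** (LLL 1977, §4
remark (ii), for `γ_{{i}}(· | η)`): the density `e^{-H_{{i}}/T}` factorises into `e^{-p_i²/(2T)}`
times a function of `q_i` (and the boundary), so by Fubini the law of `p_i` is proportional to
`e^{-p²/(2T)} dp`, and the constant is fixed by normalisation (B2). [cite: LanfordLebowitzLieb1977, §4 remark (ii)] -/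
theorem map_snd_chainSpecification_singleton (hU : Continuous P.U) (hV : Continuous P.V)
    {T : ℝ} (hT : 0 < T) (hB2 : P.CondB2 T) (i : ℤ) (η : ChainConfig) :
    (P.chainSpecification T {i} η).map (fun σ : ChainConfig => (σ i).2) = gaussianReal 0 T.toNNReal := by
  classical
  set γ := P.chainSpecification T {i} η with hγ
  haveI : IsProbabilityMeasure γ := hB2 {i} η
  have hπ : Measurable fun σ : ChainConfig => (σ i).2 := (measurable_pi_apply i).snd
  -- the density and its factorisation
  set f : ChainConfig → ℝ := fun σ => -T⁻¹ * hamiltonianIn P.chainPotential chainSupp {i} σ with hf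
  have hfm : Measurable f :=
    (measurable_const.mul (P.continuous_hamiltonianIn_chain_singleton hU hV i).measurable)
  set W : ℝ → ℝ := fun q => P.U q + (P.V ((η (i + 1)).1 - q) + P.V (q - (η (i - 1)).1)) with hW
  have hWm : Measurable W := by
    have : Continuous W := by simp only [hW]; fun_prop
    exact this.measurable
  have hfins : ∀ z : ℝ × ℝ, Real.exp (f (siteInsert i η z)) =
      Real.exp (-T⁻¹ * W z.1) * Real.exp (-z.2 ^ 2 / (2 * T)) := by
    intro z
    have hi1 : i + 1 ≠ i := by omega
    have hi2 : i - 1 ≠ i := by omega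
    rw [← Real.exp_add]
    congr 1
    simp only [hf, hamiltonianIn_chain_singleton, siteInsert_apply_self, siteInsert_apply_of_ne hi1,
      siteInsert_apply_of_ne hi2, hW]
    field_simp
    ring
  -- the a priori measure and the normaliser
  set ν₁ : Measure ChainConfig := (Measure.pi fun _ : ({i} : Finset ℤ) =>
    (volume : Measure (ℝ × ℝ))).map (fun ζ => glueWith {i} ζ η) with hν₁
  have hν₁siteInsert : ν₁ = (volume : Measure (ℝ × ℝ)).map (siteInsert i η) := map_glueWith_singleton i η
  set Z : ℝ := ∫ σ, Real.exp (f σ) ∂ν₁ with hZ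
  have hγt : γ = ν₁.tilted f := rfl
  -- constants
  set K : ℝ≥0∞ := ∫⁻ q, ENNReal.ofReal (Real.exp (-T⁻¹ * W q)) with hK
  set c : ℝ≥0∞ := ENNReal.ofReal Z⁻¹ * K with hc
  -- the key computation: `∫ g(p_i) dγ = c ∫ e^{-p²/2T} g(p) dp`
  have key : ∀ g : ℝ → ℝ≥0∞, Measurable g →
      ∫⁻ σ, g (σ i).2 ∂γ = c * ∫⁻ p, gaussWeight T p * g p := by
    intro g hg
    have hF : Measurable fun σ : ChainConfig => ENNReal.ofReal (Real.exp (f σ)) * g (σ i).2 :=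
      (ENNReal.measurable_ofReal.comp (Real.measurable_exp.comp hfm)).mul (hg.comp hπ)
    calc ∫⁻ σ, g (σ i).2 ∂γ
        = ∫⁻ σ, ENNReal.ofReal (Real.exp (f σ) / Z) * g (σ i).2 ∂ν₁ := by
          rw [hγt, lintegral_tilted]
      _ = ∫⁻ σ, ENNReal.ofReal Z⁻¹ * (ENNReal.ofReal (Real.exp (f σ)) * g (σ i).2) ∂ν₁ := by
          refine lintegral_congr fun σ => ?_
          rw [div_eq_mul_inv, ENNReal.ofReal_mul (Real.exp_pos _).le]
          ring
      _ = ENNReal.ofReal Z⁻¹ * ∫⁻ σ, ENNReal.ofReal (Real.exp (f σ)) * g (σ i).2 ∂ν₁ :=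
          lintegral_const_mul _ hF
      _ = ENNReal.ofReal Z⁻¹ * ∫⁻ z, ENNReal.ofReal (Real.exp (f (siteInsert i η z))) * g z.2 := by
          rw [hν₁siteInsert, lintegral_map hF (measurable_siteInsert i η)]
          simp only [siteInsert_apply_self]
      _ = ENNReal.ofReal Z⁻¹ * ∫⁻ z : ℝ × ℝ,
            ENNReal.ofReal (Real.exp (-T⁻¹ * W z.1)) * (gaussWeight T z.2 * g z.2) := by
          congr 1
          refine lintegral_congr fun z => ?_
          rw [hfins, ENNReal.ofReal_mul (Real.exp_pos _).le, gaussWeight, mul_assoc]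
      _ = ENNReal.ofReal Z⁻¹ * (K * ∫⁻ p, gaussWeight T p * g p) := by
          congr 1
          have h1 : Measurable fun q : ℝ => ENNReal.ofReal (Real.exp (-T⁻¹ * W q)) :=
            ENNReal.measurable_ofReal.comp (Real.measurable_exp.comp (measurable_const.mul hWm))
          have h2 : Measurable fun p : ℝ => gaussWeight T p * g p := (measurable_gaussWeight T).mul hg
          rw [Measure.volume_eq_prod]
          exact lintegral_prod_mul h1.aemeasurable h2.aemeasurable
      _ = c * ∫⁻ p, gaussWeight T p * g p := by rw [hc, mul_assoc]
  -- hence `γ ∘ p_i⁻¹ = c • (e^{-p²/2T} dp)`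
  have hmap : γ.map (fun σ : ChainConfig => (σ i).2) = c • volume.withDensity (gaussWeight T) := by
    refine Measure.ext fun S hS => ?_
    rw [Measure.map_apply hπ hS, Measure.smul_apply, withDensity_apply _ hS, smul_eq_mul,
      ← lintegral_indicator hS, ← lintegral_indicator_one (hS.preimage hπ)]
    have e1 : (fun σ : ChainConfig => ((fun σ : ChainConfig => (σ i).2) ⁻¹' S).indicator
        (1 : ChainConfig → ℝ≥0∞) σ) = fun σ => S.indicator (1 : ℝ → ℝ≥0∞) (σ i).2 := by
      funext σ; rfl
    rw [e1, key _ (measurable_one.indicator hS)]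
    congr 1
    refine lintegral_congr fun p => ?_
    by_cases hp : p ∈ S <;> simp [hp]
  -- normalisation: both sides are probability measures
  have hprob : IsProbabilityMeasure (γ.map fun σ : ChainConfig => (σ i).2) :=
    Measure.isProbabilityMeasure_map hπ.aemeasurable
  have hGu : volume.withDensity (gaussWeight T) univ = ENNReal.ofReal (Real.sqrt (2 * Real.pi * T)) := by
    rw [withDensity_apply _ MeasurableSet.univ, Measure.restrict_univ, lintegral_gaussWeight hT]
  have hcval : c = (ENNReal.ofReal (Real.sqrt (2 * Real.pi * T)))⁻¹ := by
    have h1 : c * ENNReal.ofReal (Real.sqrt (2 * Real.pi * T)) = 1 := by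
      have := hprob.measure_univ
      rwa [hmap, Measure.smul_apply, smul_eq_mul, hGu] at this
    have hne : ENNReal.ofReal (Real.sqrt (2 * Real.pi * T)) ≠ 0 := by
      exact (ENNReal.ofReal_pos.2 (Real.sqrt_pos.2 (by positivity))).ne'
    rw [← mul_one c, ← ENNReal.mul_inv_cancel hne ENNReal.ofReal_ne_top, ← mul_assoc, h1, one_mul]
  rw [hmap, hcval, gaussianReal_eq_smul_withDensity hT]

/-- **Momenta are `N(0, T)` under every Gibbs state** (LLL 1977, §4 remark (ii)): for a Gibbs
state `μ` of the chain at temperature `T > 0` (B2), `μ ∘ p_i⁻¹ = gaussianReal 0 T` for every site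
`i` (DLR with `Λ = {i}` and `map_snd_chainSpecification_singleton`). [cite: LanfordLebowitzLieb1977, §4 remark (ii)] -/
theorem map_snd_eq_gaussianReal (hU : Continuous P.U) (hV : Continuous P.V) {T : ℝ} (hT : 0 < T)
    (hB2 : P.CondB2 T) {μ : Measure ChainConfig} (hμ : P.IsChainGibbsMeasure T μ) (i : ℤ) :
    μ.map (fun σ : ChainConfig => (σ i).2) = gaussianReal 0 T.toNNReal := by
  haveI : IsProbabilityMeasure μ := hμ.1
  have hπ : Measurable fun σ : ChainConfig => (σ i).2 := (measurable_pi_apply i).snd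
  refine Measure.ext fun S hS => ?_
  rw [Measure.map_apply hπ hS, ← hμ.2 {i} _ (hS.preimage hπ)]
  have h : ∀ η : ChainConfig, P.chainSpecification T {i} η ((fun σ : ChainConfig => (σ i).2) ⁻¹' S) =
      gaussianReal 0 T.toNNReal S := fun η => by
    rw [← Measure.map_apply hπ hS, map_snd_chainSpecification_singleton hU hV hT hB2 i η]
  show ∫⁻ η, P.chainSpecification T {i} η ((fun σ : ChainConfig => (σ i).2) ⁻¹' S) ∂μ = _
  simp only [h, lintegral_const, measure_univ, mul_one]

/-- `∫ g(p_i) dμ = ∫ g dN(0, T)` for every Gibbs state and every measurable `g ≥ 0`. [cite: LanfordLebowitzLieb1977, §4 remark (ii)] -/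
theorem lintegral_comp_snd_eq (hU : Continuous P.U) (hV : Continuous P.V) {T : ℝ} (hT : 0 < T)
    (hB2 : P.CondB2 T) {μ : Measure ChainConfig} (hμ : P.IsChainGibbsMeasure T μ) (i : ℤ)
    {g : ℝ → ℝ≥0∞} (hg : Measurable g) :
    ∫⁻ σ, g (σ i).2 ∂μ = ∫⁻ p, g p ∂(gaussianReal 0 T.toNNReal) := by
  rw [← map_snd_eq_gaussianReal hU hV hT hB2 hμ i, lintegral_map hg (measurable_pi_apply i).snd]

/-- **The exponential moment used in the proof of LLL Thm 3**: `∫ e^{p_i²/(4T)} dμ = √2` for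
every Gibbs state at temperature `T` and every site. [folklore] -/
theorem lintegral_exp_sq_snd (hU : Continuous P.U) (hV : Continuous P.V) {T : ℝ} (hT : 0 < T)
    (hB2 : P.CondB2 T) {μ : Measure ChainConfig} (hμ : P.IsChainGibbsMeasure T μ) (i : ℤ) :
    ∫⁻ σ, ENNReal.ofReal (Real.exp ((σ i).2 ^ 2 / (4 * T))) ∂μ = ENNReal.ofReal (Real.sqrt 2) := by
  have hg : Measurable fun p : ℝ => ENNReal.ofReal (Real.exp (p ^ 2 / (4 * T))) :=
    ENNReal.measurable_ofReal.comp (by fun_prop)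
  rw [lintegral_comp_snd_eq hU hV hT hB2 hμ i hg, gaussianReal_eq_smul_withDensity hT,
    lintegral_smul_measure, lintegral_withDensity_eq_lintegral_mul _ (measurable_gaussWeight T) hg]
  have e : (fun p : ℝ => (gaussWeight T * fun p => ENNReal.ofReal (Real.exp (p ^ 2 / (4 * T)))) p) =
      fun p => ENNReal.ofReal (Real.exp (-(1 / (4 * T)) * p ^ 2)) := by
    funext p
    simp only [Pi.mul_apply, gaussWeight]
    rw [← ENNReal.ofReal_mul (Real.exp_pos _).le, ← Real.exp_add]
    congr 2
    field_simp
    ring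
  have hb : 0 < 1 / (4 * T) := by positivity
  rw [e, ← ofReal_integral_eq_lintegral_ofReal (integrable_exp_neg_mul_sq hb)
    (Eventually.of_forall fun p => (Real.exp_pos _).le), integral_gaussian, smul_eq_mul,
    ← ENNReal.ofReal_inv_of_pos (by positivity), ← ENNReal.ofReal_mul (by positivity)]
  congr 1
  have h4 : Real.pi / (1 / (4 * T)) = 2 * (2 * Real.pi * T) := by field_simp; ring
  rw [h4, Real.sqrt_mul' _ (by positivity : 0 ≤ 2 * Real.pi * T),
    inv_mul_eq_div]
  have hs : 0 < Real.sqrt (2 * Real.pi * T) := Real.sqrt_pos.2 (by positivity)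
  field_simp

end OscillatorChain

end Literature.MathematicalPhysics.KineticTheory.HeatConduction

end
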